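import Summits.Ventures.YMGap.RobustBall.RobustAreaLawVertex
import HarnessLib

/-!
# Robust ball (Y2), area-law side — the robust Durhuus–Fröhlich criterion at FULL RATE with explicit
constants, and the explicit-rate torus area law on the ball

HONEST FRAMING: venture file of the cell `pub-ymgap` (QuantumFields programme), track ROBUST-BALL, seat rb-p2 (g4).
Strong-coupling LATTICE statements on the finite tori `(ℤ/L)^{n+1}` (uniform in `L`) for the `SU(N)` theory with a PERTURBED
action `Nβ S_W + W`, `W` in the tier-1 ball `ClusterDomainFR ε₀ ε₁ r ∩ IsSlabLocal mv`.  WHAT IS NEW HERE is only bookkeeping: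
the landed criterion `robust_slab_criterion` trades HALF of the slab mass `C₂` for an `R`-free prefactor
(`e^{-(C₂/2mv)RT}`); its public intermediate `abs_loopRatio_le_peelBound` is sharp, and with `T/mv ≤ peelCount ≤ T` it gives
`|⟨W_{R×T}⟩_{β,W,L}| ≤ N · (N² · max(4C₁,1))^T · e^{-(C₂/mv) R T}` — the FULL slab mass in the area exponent with a perimeter-type
prefactor, i.e. exactly the shape `C^{2(R+T)} e^{-cRT}` of the tree's `HasAreaLawWith`.  Composed with the robust slab door
(`slab_covariance_le_W`, constants `C₁ = 8N/c'`, `C₂ = (-log c')/r_W`, here with a FREE floor `c' = max(c, θ)`, `0 < θ ≤ 1`, instead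
of the landed `θ = 1/2`) this is an EXPLICIT-RATE area law on the ball: rate `(-log max(c, θ))/(max(n r, 1) · mv)` with `c` the member's
Dobrushin row constant `e^{ε₀}(1 + 2√N ε₁)(2n|β/N|K) + √N ε₁`.  Nothing about the continuum, a spectral gap, or Clay; the rates are
door artefacts (Dobrushin constants), not the physical string tension.

References: Cao–Nissim–Sheffield arXiv:2509.04688v2 Thm 2.3; Durhuus–Fröhlich CMP 75 (1980); H. Föllmer, LNM 1362 (1988) Ch. I.
-/

noncomputable section

open MeasureTheory ProbabilityTheory
open scoped Matrix
open Literature.Probability.LatticeModels hiding glue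
open Literature.Probability.LatticeModels.DobrushinMetric
open Literature.MathematicalPhysics.QuantumLattice (fundamentalRep continuous_fundamentalRep fundamentalRep_apply)
open Literature.MathematicalPhysics.QuantumFieldTheory
open Literature.MathematicalPhysics.QuantumFieldTheory.DurhuusFrohlich
open Literature.MathematicalPhysics.QuantumFieldTheory.Balaban1983to89.StrongCouplingDobrushinWindow (OneLinkKRModulus)

namespace Summit.Ventures.YMGap.RobustBall

variable {n L N : ℕ}

/-! ### The sparse peeling at full rate -/

section Peeling

/-- At most one integration per processed leg: `peelCount m a s ≤ s`. [folklore] -/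
theorem peelCount_le (m : ℕ) : ∀ s a, peelCount m a s ≤ s := by
  intro s
  induction s with
  | zero => intro a; simp [peelCount]
  | succ s ih =>
    intro a
    cases a with
    | zero => rw [peelCount]; have := ih (m - 1); omega
    | succ a => rw [peelCount]; have := ih a; omega

/-- **The peeling constant at FULL rate**: with `ε = 4C₁e^{-C₂R}` and `M = max(4C₁, 1)`,
`peelBound N m ε 0 T = N^{2T} ε^{peelCount} ≤ N^{2T} · M^T · e^{-(C₂/m) R T}` — because `T/m ≤ peelCount ≤ T`
(`le_mul_peelCount`, `peelCount_le`) and `ε ≤ M e^{-C₂R}`.  No largeness condition on `R`. [folklore] -/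
theorem peelBound_le_full_rate {m : ℕ} (hm : 1 ≤ m) {C₁ C₂ : ℝ} (hC₁ : 0 ≤ C₁) (hC₂ : 0 ≤ C₂) (R T : ℕ) :
    peelBound N m (4 * C₁ * Real.exp (-C₂ * R)) 0 T ≤
      ((N : ℝ) ^ 2) ^ T * (max (4 * C₁) 1) ^ T * Real.exp (-(C₂ / m) * ((R : ℝ) * T)) := by
  set c := peelCount m 0 T with hc
  set M : ℝ := max (4 * C₁) 1 with hM
  have hTc : T ≤ m * c := by have := le_mul_peelCount m T 0 (by omega); omega
  have hcT : c ≤ T := peelCount_le m T 0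
  have hM1 : 1 ≤ M := le_max_right _ _
  have hε0 : 0 ≤ 4 * C₁ * Real.exp (-C₂ * R) := by positivity
  have hεM : 4 * C₁ * Real.exp (-C₂ * R) ≤ M * Real.exp (-C₂ * R) :=
    mul_le_mul_of_nonneg_right (le_max_left _ _) (Real.exp_pos _).le
  have key : (4 * C₁ * Real.exp (-C₂ * R)) ^ c ≤ M ^ T * Real.exp (-(C₂ / m) * ((R : ℝ) * T)) :=
    calc (4 * C₁ * Real.exp (-C₂ * R)) ^ c ≤ (M * Real.exp (-C₂ * R)) ^ c := pow_le_pow_left₀ hε0 hεM c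
      _ = M ^ c * Real.exp ((c : ℝ) * (-C₂ * R)) := by rw [mul_pow, ← Real.exp_nat_mul]
      _ ≤ M ^ T * Real.exp (-(C₂ / m) * ((R : ℝ) * T)) := by
          refine mul_le_mul (pow_le_pow_right₀ hM1 hcT) (Real.exp_le_exp.2 ?_) (Real.exp_pos _).le (by positivity)
          have hmr : (0 : ℝ) < m := by exact_mod_cast (show 0 < m by omega)
          have hTc' : (T : ℝ) ≤ (m : ℝ) * c := by exact_mod_cast hTc
          have hR0 : (0 : ℝ) ≤ C₂ * R := by positivity
          rw [show -(C₂ / m) * ((R : ℝ) * T) = -(C₂ * R) * (T / m) by field_simp]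
          have h1 : (T : ℝ) / m ≤ c := (div_le_iff₀ hmr).2 (by linarith)
          nlinarith
  rw [peelBound_eq N m _ T 0]
  calc ((N : ℝ) ^ 2) ^ T * (4 * C₁ * Real.exp (-C₂ * R)) ^ c
      ≤ ((N : ℝ) ^ 2) ^ T * (M ^ T * Real.exp (-(C₂ / m) * ((R : ℝ) * T))) :=
        mul_le_mul_of_nonneg_left key (by positivity)
    _ = _ := by ring

variable [NeZero L] {W : GaugeConfig (n + 1) L (SU N) → ℝ}

/-- **ROBUST DURHUUS–FRÖHLICH CRITERION AT FULL RATE (explicit constants).**  Under (HCentre) and (HLoc, vertical range `m`) for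
the vertical direction `j` and rest-uniform clustering `(C₁, C₂)` of the perturbed `j`-slab laws, every `R × T` loop in an `(i, j)`
plane with `2R, 2T ≤ L` obeys `|⟨W_{R×T}⟩_{Nβ,W}| ≤ N · (N² · max(4C₁,1))^T · e^{-(C₂/m) R T}`: the FULL slab mass `C₂/m` in the
area exponent (the landed `robust_slab_criterion` has `C₂/2m`), perimeter-type prefactor. [cite: CaoNissimSheffield2025dynamical, Theorem 2.3] -/
theorem abs_loopRatio_le_full_rate (hN : 2 ≤ N) (β : ℝ) (hWm : Measurable W) (hWb : ∃ C, ∀ U, |W U| ≤ C)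
    {m : ℕ} (hm : 1 ≤ m) {j : Fin (n + 1)} (hloc : HasVerticalRange W j m)
    (hWc : ∀ (t : ZMod L) U, W (slabRotate (centre N (by omega)) j t U) = W U) {C₁ C₂ : ℝ} (hC₁ : 0 ≤ C₁)
    (hC₂ : 0 ≤ C₂)
    (hcov : ∀ (t : ZMod L) (r : {e : Edge (n + 1) L // ¬ IsSlab j t e} → SU N) (x y : Site n L) (i j' k l : Fin N)
      (φ ψ : ℂ → ℝ), (φ = Complex.re ∨ φ = Complex.im) → (ψ = Complex.re ∨ ψ = Complex.im) →
        |cov[fun Q => φ ((Q x : Matrix (Fin N) (Fin N) ℂ) i j'),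
            fun Q => ψ ((((Q y)⁻¹ : Matrix.specialUnitaryGroup (Fin N) ℂ) :
              Matrix (Fin N) (Fin N) ℂ) k l); slabLawW j t β W r]| ≤ C₁ * Real.exp (-C₂ * torusGraphDist x y))
    (x : Site (n + 1) L) {i : Fin (n + 1)} (hij : i ≠ j) {R T : ℕ} (hRL : 2 * R ≤ L) (hTL : 2 * T ≤ L) :
    |(∫ U, wilsonLoop (fundamentalRep (Fin N)) x i j R T U * weightW N β W U ∂(linkMeasure n L N)) /
        ∫ U, weightW N β W U ∂(linkMeasure n L N)| ≤
      N * ((N : ℝ) ^ 2 * max (4 * C₁) 1) ^ T * Real.exp (-(C₂ / m) * ((R : ℝ) * T)) := by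
  have h := abs_loopRatio_le_peelBound (n := n) (L := L) (N := N) hN β hWm hWb hm hloc hWc hcov x hij hRL hTL
  have hNr : (0 : ℝ) ≤ N := Nat.cast_nonneg N
  have hp := peelBound_le_full_rate (N := N) hm hC₁ hC₂ R T
  calc _ ≤ _ := h
    _ ≤ (N : ℝ) * (((N : ℝ) ^ 2) ^ T * (max (4 * C₁) 1) ^ T * Real.exp (-(C₂ / m) * ((R : ℝ) * T))) :=
        mul_le_mul_of_nonneg_left hp hNr
    _ = N * ((N : ℝ) ^ 2 * max (4 * C₁) 1) ^ T * Real.exp (-(C₂ / m) * ((R : ℝ) * T)) := by rw [mul_pow]; ring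

end Peeling

/-! ### The robust slab door with a free floor `θ` (the landed door is `θ = 1/2`) -/

section Door

/-- `c^{⌊d/r⌋} ≤ c'⁻¹ · e^{-((-log c')/r) d}` for `0 ≤ c ≤ c'`, `0 < c' ≤ 1`, `r ≥ 1`. [folklore] -/
theorem pow_div_le_exp_of_le {c c' : ℝ} (hc0 : 0 ≤ c) (hcc' : c ≤ c') (hc'0 : 0 < c') (hc'1 : c' ≤ 1) {rW : ℕ}
    (hrW : 1 ≤ rW) (d : ℕ) :
    c ^ (d / rW) ≤ c'⁻¹ * Real.exp (-(-Real.log c' / rW) * d) := by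
  have hlog : Real.log c' ≤ 0 := Real.log_nonpos hc'0.le hc'1
  set q : ℕ := d / rW with hq
  have hrW' : (0 : ℝ) < rW := by exact_mod_cast (show 0 < rW by omega)
  have hdq : (d : ℝ) / rW ≤ q + 1 := by
    rw [div_le_iff₀ hrW']
    have h1 : d < rW * (q + 1) := by
      have := Nat.div_add_mod d rW
      have := Nat.mod_lt d (show 0 < rW by omega)
      rw [hq]; nlinarith
    have h2 : (d : ℝ) < (rW : ℝ) * (q + 1) := by exact_mod_cast h1
    linarith
  calc c ^ q ≤ c' ^ q := pow_le_pow_left₀ hc0 hcc' q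
    _ = Real.exp (q * Real.log c') := by rw [Real.exp_nat_mul, Real.exp_log hc'0]
    _ ≤ Real.exp (-Real.log c' + Real.log c' / rW * d) := by
        refine Real.exp_le_exp.2 ?_
        have : Real.log c' * ((q : ℝ) + 1 - d / rW) ≤ 0 := mul_nonpos_of_nonpos_of_nonneg hlog (by linarith)
        have hq' : Real.log c' / rW * d = Real.log c' * (d / rW) := by field_simp
        rw [hq']; nlinarith
    _ = c'⁻¹ * Real.exp (-(-Real.log c' / rW) * d) := by
        rw [Real.exp_add, Real.exp_neg, Real.exp_log hc'0]; ring_nf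

variable [NeZero L] {W : GaugeConfig (n + 1) L (SU N) → ℝ}

/-- **THE ROBUST SLAB DOOR IN CLUSTERING SHAPE, FREE FLOOR.**  Same hypotheses as the landed `slabLawW_entry_cov_le` (one-link
modulus on the slab ball, per-site loads `δ, ℓ, Λ` of the re-weighting, row sum `c ≤ 1`, neighbourhoods of graph-diameter `≤ r_W`),
with a floor `0 < θ ≤ 1` in place of `1/2`: for all sites `x, y`, indices and `φ, ψ ∈ {Re, Im}`,
`|Cov_{slabLawW}(φ(Q_x)_{ij}, ψ(Q_y⁻¹)_{kl})| ≤ (8N/c') e^{-((-log c')/r_W) d(x,y)}`, `c' = max(c, θ)` — so for `θ ≤ c` the rate is the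
full `-log c / r_W`. [cite: CaoNissimSheffield2025dynamical, Theorem 2.3] [cite: Follmer1988, Ch. I Theorem (2.13)] -/
theorem slabLawW_entry_cov_le_floor (hN : 1 ≤ N) (v : Fin (n + 1)) (t : ZMod L)
    {β R K δ ℓ Λ₀ : ℝ} (hK : 0 ≤ K) (hℓ : 0 ≤ ℓ) (hR : |β| * (2 * (n : ℝ)) ≤ R) (hmod : OneLinkKRModulus N R K)
    (hWm : Measurable W) (hWb : ∃ C, ∀ U, |W U| ≤ C) (r : {e : Edge (n + 1) L // ¬ IsSlab v t e} → SU N)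
    (nbrW : TorusSite n L → Finset (TorusSite n L)) (hnotW : ∀ x, x ∉ nbrW x)
    (hdep : ∀ x (η η' : TorusSite n L → SU N), (∀ z ∈ Slab.slabNbr x ∪ nbrW x, η z = η' z) →
      ∃ c : ℝ, ∀ g, siteTiltW v t W r x η g = c + siteTiltW v t W r x η' g)
    (hδ : ∀ x ω g g', siteTiltW v t W r x ω g - siteTiltW v t W r x ω g' ≤ δ)
    (hℓ' : ∀ x ω g g', |siteTiltW v t W r x ω g - siteTiltW v t W r x ω g'| ≤ ℓ * suFrobDist g g')
    (Λ : TorusSite n L → TorusSite n L → ℝ) (hΛ0 : ∀ x y, 0 ≤ Λ x y)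
    (hΛ : ∀ x y (ω η : TorusSite n L → SU N), (∀ z, z ≠ y → ω z = η z) → ∃ c : ℝ, ∀ g,
      |siteTiltW v t W r x ω g - (c + siteTiltW v t W r x η g)| ≤ Λ x y * suFrobDist (ω y) (η y))
    (hrow : ∀ x, ∑ y ∈ Slab.slabNbr x ∪ nbrW x, Λ x y ≤ Λ₀)
    (hc1 : Real.exp δ * (1 + 2 * Real.sqrt N * ℓ) * (2 * (n : ℝ) * |β| * K) + Real.sqrt N * Λ₀ ≤ 1)
    {rW : ℕ} (hrW : 1 ≤ rW) (hrange : ∀ z, ∀ w ∈ Slab.slabNbr z ∪ nbrW z, torusGraphDist z w ≤ rW)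
    {θ : ℝ} (hθ0 : 0 < θ) (hθ1 : θ ≤ 1)
    (x y : TorusSite n L) (i j k l : Fin N) (φ ψ : ℂ → ℝ)
    (hφ : φ = Complex.re ∨ φ = Complex.im) (hψ : ψ = Complex.re ∨ ψ = Complex.im) :
    |cov[fun Q => φ ((Q x : Matrix (Fin N) (Fin N) ℂ) i j),
        fun Q => ψ ((((Q y)⁻¹ : Matrix.specialUnitaryGroup (Fin N) ℂ) : Matrix (Fin N) (Fin N) ℂ) k l);
        slabLawW v t β W r]| ≤
      8 * N * (max (Real.exp δ * (1 + 2 * Real.sqrt N * ℓ) * (2 * (n : ℝ) * |β| * K) + Real.sqrt N * Λ₀) θ)⁻¹ *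
        Real.exp (-(-Real.log (max (Real.exp δ * (1 + 2 * Real.sqrt N * ℓ) * (2 * (n : ℝ) * |β| * K) + Real.sqrt N * Λ₀)
          θ) / rW) * torusGraphDist x y) := by
  classical
  set c : ℝ := Real.exp δ * (1 + 2 * Real.sqrt N * ℓ) * (2 * (n : ℝ) * |β| * K) + Real.sqrt N * Λ₀ with hc
  have hΛ₀ : 0 ≤ Λ₀ := (Finset.sum_nonneg fun z _ => hΛ0 x z).trans (hrow x)
  have hc0 : 0 ≤ c := by positivity
  set c' : ℝ := max c θ with hc'
  have hc'0 : 0 < c' := lt_max_of_lt_right hθ0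
  have hc'1 : c' ≤ 1 := max_le hc1 hθ1
  haveI := isProbabilityMeasure_slabLawW (n := n) (L := L) (N := N) v t β hWm hWb r
  obtain ⟨hfm, hfdep, hf1, hfL⟩ := Slab.entryObs_props (n := n) (L := L) x i j hφ
  obtain ⟨hgm, hgdep, hg1, hgL⟩ := Slab.invEntryObs_props (n := n) (L := L) y k l hψ
  have hN8 : (2 : ℝ) * (2 * Real.sqrt N) ^ 2 = 8 * N := by
    rw [mul_pow, Real.sq_sqrt (Nat.cast_nonneg N)]; ring
  have hNr : (1 : ℝ) ≤ N := by exact_mod_cast hN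
  by_cases hL1 : L = 1
  · subst hL1
    have hxy : x = y := Subsingleton.elim _ _
    subst hxy
    have h4 := Slab.abs_cov_le_of_abs_le (μ := slabLawW v t β W r) hf1 hg1
    rw [torusGraphDist_self, Nat.cast_zero, mul_zero, Real.exp_zero, mul_one]
    have hinv : (1 : ℝ) ≤ c'⁻¹ := one_le_inv_iff₀.2 ⟨hc'0, hc'1⟩
    calc _ ≤ 2 * 1 * (2 * 1) := h4
      _ ≤ 8 * N * c'⁻¹ := by nlinarith
  · obtain ⟨hp0, hp⟩ := div_profile (n := n) (L := L) y hrW (fun z => Slab.slabNbr z ∪ nbrW z) hrange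
    have key := slab_covariance_le_W hN hL1 v t hK hℓ hR hmod hWm hWb r nbrW hnotW hdep hδ hℓ' Λ hΛ0 hΛ hrow hc1 x y
      hfm hfdep hf1 hfL hgm hgdep hg1 hgL (fun z => torusGraphDist z y / rW) hp0 hp
    have hexp := pow_div_le_exp_of_le hc0 (le_max_left c θ) hc'0 hc'1 hrW (torusGraphDist x y)
    calc _ ≤ 2 * (2 * Real.sqrt N) ^ 2 * 1 * (c ^ (torusGraphDist x y / rW) * 1) := key
      _ = 8 * N * c ^ (torusGraphDist x y / rW) := by rw [← hN8]; ring
      _ ≤ 8 * N * (c'⁻¹ * Real.exp (-(-Real.log c' / rW) * torusGraphDist x y)) :=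
          mul_le_mul_of_nonneg_left hexp (by positivity)
      _ = 8 * N * c'⁻¹ * Real.exp (-(-Real.log c' / rW) * torusGraphDist x y) := by ring

/-- The floor-`θ` door rate is nonnegative. [folklore] -/
theorem doorRate_floor_nonneg {c θ : ℝ} (hc1 : c ≤ 1) (hθ0 : 0 < θ) (hθ1 : θ ≤ 1) (rW : ℕ) :
    0 ≤ -Real.log (max c θ) / rW :=
  div_nonneg (neg_nonneg.2 (Real.log_nonpos (lt_max_of_lt_right hθ0).le (max_le hc1 hθ1))) (Nat.cast_nonneg _)

end Door

/-! ### Quasi-local perturbations: all directions at once -/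

section QuasiLocal

variable [NeZero L]

/-- **FULL-RATE CRITERION for quasi-local gauge perturbations** (`QuasiLocalGaugePerturbation`): (HCentre) + (HLoc, vertical range
`m`) for `W.total` in every direction and rest-uniform clustering `(C₁, C₂)` of the perturbed slab laws ⇒ for every loop with
`2R, 2T ≤ L`: `|⟨W_{R×T}⟩_{μ_{Nβ,W}}| ≤ N · (N² · max(4C₁,1))^T · e^{-(C₂/m) R T}`. [cite: CaoNissimSheffield2025dynamical, Theorem 2.3] -/
theorem abs_expectation_wilsonLoop_le_full_rate (hN : 2 ≤ N) (β : ℝ) {b : ℕ}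
    (W : QuasiLocalGaugePerturbation (n + 1) L (SU N) b) {m : ℕ} (hm : 1 ≤ m)
    (hloc : ∀ v : Fin (n + 1), HasVerticalRange W.total v m)
    (hWc : ∀ (v : Fin (n + 1)) (t : ZMod L) U, W.total (slabRotate (centre N (by omega)) v t U) = W.total U)
    {C₁ C₂ : ℝ} (hC₁ : 0 ≤ C₁) (hC₂ : 0 ≤ C₂)
    (hcov : ∀ (v : Fin (n + 1)) (t : ZMod L) (r : {e : Edge (n + 1) L // ¬ IsSlab v t e} → SU N) (x y : Site n L)
      (i j k l : Fin N) (φ ψ : ℂ → ℝ), (φ = Complex.re ∨ φ = Complex.im) → (ψ = Complex.re ∨ ψ = Complex.im) →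
        |cov[fun Q => φ ((Q x : Matrix (Fin N) (Fin N) ℂ) i j),
            fun Q => ψ ((((Q y)⁻¹ : Matrix.specialUnitaryGroup (Fin N) ℂ) :
              Matrix (Fin N) (Fin N) ℂ) k l); slabLawW v t β W.total r]| ≤ C₁ * Real.exp (-C₂ * torusGraphDist x y))
    (x : Site (n + 1) L) {i j : Fin (n + 1)} (hij : i ≠ j) {R T : ℕ} (hRL : 2 * R ≤ L) (hTL : 2 * T ≤ L) :
    |W.expectation (fundamentalRep (Fin N)) ((N : ℝ) * β) (wilsonLoop (fundamentalRep (Fin N)) x i j R T)| ≤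
      N * ((N : ℝ) ^ 2 * max (4 * C₁) 1) ^ T * Real.exp (-(C₂ / m) * ((R : ℝ) * T)) := by
  rw [expectation_eq_loopRatio]
  exact abs_loopRatio_le_full_rate hN β W.measurable_total W.exists_abs_total_le hm (hloc j) (hWc j) hC₁ hC₂
    (hcov j) x hij hRL hTL

end QuasiLocal

/-! ### The explicit-rate area law on the ball (lossy door, free floor) -/

section Ball

/-- **Slab covariance on the ball, lossy door with free floor `θ`** (the landed `slabCovariance_of_oneLinkKRModulus` is `θ = 1/2`):
with `c = e^{ε₀}(1 + 2√N ε₁)(2n|βt|K) + √N ε₁ ≤ 1` and `c' = max(c, θ)`, the perturbed slab laws of every member of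
`ClusterDomainFR ε₀ ε₁ r` cluster with constants `(8N/c', (−log c')/max(n r, 1))`, uniformly in the rest, the height, the direction
and `L`. [cite: CaoNissimSheffield2025dynamical, Theorem 2.3] -/
theorem slabCovariance_of_oneLinkKRModulus_floor (hN : 1 ≤ N) (βt : ℝ) {R K : ℝ} (hK : 0 ≤ K) (hmod : OneLinkKRModulus N R K)
    (hR : |βt| * (2 * (n : ℝ)) ≤ R) {ε₀ ε₁ : ℝ} (h₁ : 0 ≤ ε₁) (r : ℕ)
    (hc : Real.exp ε₀ * (1 + 2 * Real.sqrt N * ε₁) * (2 * (n : ℝ) * |βt| * K) + Real.sqrt N * ε₁ ≤ 1)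
    {θ : ℝ} (hθ0 : 0 < θ) (hθ1 : θ ≤ 1)
    (L : ℕ) [NeZero L] (W : Perturbation (n + 1) L N) (hWball : W ∈ ClusterDomainFR ε₀ ε₁ r)
    (v : Fin (n + 1)) (t : ZMod L) (rest : {e : Edge (n + 1) L // ¬ IsSlab v t e} → SU N) (x y : Site n L)
    (i j k l : Fin N) (φ ψ : ℂ → ℝ) (hφ : φ = Complex.re ∨ φ = Complex.im) (hψ : ψ = Complex.re ∨ ψ = Complex.im) :
    |cov[fun Q => φ ((Q x : Matrix (Fin N) (Fin N) ℂ) i j),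
        fun Q => ψ ((((Q y)⁻¹ : Matrix.specialUnitaryGroup (Fin N) ℂ) : Matrix (Fin N) (Fin N) ℂ) k l);
        slabLawW v t βt W.total rest]| ≤
      8 * N * (max (Real.exp ε₀ * (1 + 2 * Real.sqrt N * ε₁) * (2 * (n : ℝ) * |βt| * K) + Real.sqrt N * ε₁) θ)⁻¹ *
        Real.exp (-(-Real.log (max (Real.exp ε₀ * (1 + 2 * Real.sqrt N * ε₁) * (2 * (n : ℝ) * |βt| * K) + Real.sqrt N * ε₁)
          θ) / (max (n * r) 1 : ℕ)) * torusGraphDist x y) := by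
  classical
  obtain ⟨hrange, w, hosc, hlip⟩ := hWball
  have hsl : ∀ e, w.selfLipLoad 0 e ≤ ε₁ := fun e =>
    le_trans (le_add_of_nonneg_right (Finset.sum_nonneg fun y _ => crossLip_nonneg w 0 e y)) (hlip e)
  have hcl : ∀ e, w.crossLipLoad 0 e ≤ ε₁ := fun e =>
    le_trans (le_add_of_nonneg_left (Finset.sum_nonneg fun X _ =>
      mul_nonneg (Real.exp_pos _).le ((w.lip_spec X).nonneg e))) (hlip e)
  exact slabLawW_entry_cov_le_floor (n := n) (L := L) (N := N) (W := W.total) hN v t (β := βt) (R := R) (K := K)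
    (δ := ε₀) (ℓ := ε₁) (Λ₀ := ε₁) hK h₁ hR hmod W.measurable_total W.exists_abs_total_le rest (nbrBall r)
    (not_mem_nbrBall r) (fun x' η η' h => siteTiltW_total_dep W rest hrange x' η η' h)
    (fun x' ω g g' => (siteTiltW_total_osc W rest w x' ω g g').trans (hosc _))
    (fun x' ω g g' => (siteTiltW_total_lip W rest w x' ω g g').trans
      (mul_le_mul_of_nonneg_right (hsl _) (suFrobDist_nonneg _ _)))
    (crossCoeff W w v t) (fun x' y' => crossCoeff_nonneg W w x' y')
    (fun x' y' ω η h => siteTiltW_total_cross W rest w x' y' h)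
    (fun x' => (crossCoeff_rowsum_le W w r x').trans (hcl _)) hc (le_max_right _ _)
    (fun z w' hw' => dist_le_of_mem_nbr r z w' hw') hθ0 hθ1 x y i j k l φ ψ hφ hψ

/-- **EXPLICIT-RATE AREA LAW ON THE BALL** (tree coupling `β`, 't Hooft `β/N`; lossy robust slab door with free floor `θ ∈ (0,1]`).
Let `N ≥ 2`, `OneLinkKRModulus N R K` on the slab ball `R ≥ 2n|β/N|`, `0 ≤ ε₁`, a range `r`, a vertical diameter `mv ≥ 1`, and the
ROW CONDITION `c := e^{ε₀}(1 + 2√N ε₁)(2n|β/N|K) + √N ε₁ ≤ 1`; put `c' = max(c, θ)`, `r_W = max(n r, 1)`.  Then for every torus `L`,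
every member `W ∈ ClusterDomainFR ε₀ ε₁ r` with `IsSlabLocal mv W` and every rectangular `R' × T` loop with `2R', 2T ≤ L`:
`|⟨W_{R'×T}⟩_{μ_{β,W,L}}| ≤ N · (32 N³ / c')^T · exp(−((−log c')/(r_W · mv)) · R' T)` — the area exponent carries the FULL slab mass
`(−log c')/r_W` of the door divided by the vertical diameter, nothing else. [cite: CaoNissimSheffield2025dynamical, Theorem 2.3] -/
theorem abs_expectation_wilsonLoop_le_onBall (hN : 2 ≤ N) (β : ℝ) {R K : ℝ} (hK : 0 ≤ K) (hmod : OneLinkKRModulus N R K)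
    (hR : |β / N| * (2 * (n : ℝ)) ≤ R) {ε₀ ε₁ : ℝ} (h₁ : 0 ≤ ε₁) (r : ℕ) {mv : ℕ} (hmv : 1 ≤ mv)
    (hc : Real.exp ε₀ * (1 + 2 * Real.sqrt N * ε₁) * (2 * (n : ℝ) * |β / N| * K) + Real.sqrt N * ε₁ ≤ 1)
    {θ : ℝ} (hθ0 : 0 < θ) (hθ1 : θ ≤ 1)
    (L : ℕ) [NeZero L] (W : Perturbation (n + 1) L N) (hWball : W ∈ ClusterDomainFR ε₀ ε₁ r) (hWloc : IsSlabLocal mv W)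
    (x : Site (n + 1) L) {i j : Fin (n + 1)} (hij : i ≠ j) {R' T : ℕ} (hRL : 2 * R' ≤ L) (hTL : 2 * T ≤ L) :
    |W.expectation (fundamentalRep (Fin N)) β (wilsonLoop (fundamentalRep (Fin N)) x i j R' T)| ≤
      N * (32 * (N : ℝ) ^ 3 /
          max (Real.exp ε₀ * (1 + 2 * Real.sqrt N * ε₁) * (2 * (n : ℝ) * |β / N| * K) + Real.sqrt N * ε₁) θ) ^ T *
        Real.exp (-(-Real.log (max (Real.exp ε₀ * (1 + 2 * Real.sqrt N * ε₁) * (2 * (n : ℝ) * |β / N| * K) +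
          Real.sqrt N * ε₁) θ) / ((max (n * r) 1 : ℕ) * mv)) * ((R' : ℝ) * T)) := by
  set c : ℝ := Real.exp ε₀ * (1 + 2 * Real.sqrt N * ε₁) * (2 * (n : ℝ) * |β / N| * K) + Real.sqrt N * ε₁ with hc_def
  set c' : ℝ := max c θ with hc'
  set rW : ℕ := max (n * r) 1 with hrW
  have hc'0 : 0 < c' := lt_max_of_lt_right hθ0
  have hc'1 : c' ≤ 1 := max_le hc hθ1
  have hNr : (N : ℝ) ≠ 0 := by exact_mod_cast (show N ≠ 0 by omega)
  have hN1 : (1 : ℝ) ≤ N := by exact_mod_cast (show 1 ≤ N by omega)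
  have hβ : (N : ℝ) * (β / N) = β := by field_simp
  have hC₁ : 0 ≤ 8 * N * c'⁻¹ := by positivity
  have hC₂ : 0 ≤ -Real.log c' / rW := doorRate_floor_nonneg hc hθ0 hθ1 rW
  have h := abs_expectation_wilsonLoop_le_full_rate (n := n) (L := L) hN (β / N) W hmv
    (fun v => hasVerticalRange_total_of_isSlabLocal hWloc v)
    (fun v t U => total_slabRotate_centre_of_isSlabLocal (by omega) hWloc v t U) hC₁ hC₂
    (fun v t rest x' y' i' j' k' l' φ ψ hφ hψ =>
      slabCovariance_of_oneLinkKRModulus_floor (n := n) (by omega) (β / N) hK hmod hR h₁ r hc hθ0 hθ1 L W hWball v t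
        rest x' y' i' j' k' l' φ ψ hφ hψ) x hij hRL hTL
  rw [hβ] at h
  -- constants: `max(4C₁, 1) = 32N/c'` and `(C₂/r_W)/mv = C₂/(r_W mv)`
  have hinv : (1 : ℝ) ≤ c'⁻¹ := one_le_inv_iff₀.2 ⟨hc'0, hc'1⟩
  have hmax : max (4 * (8 * N * c'⁻¹)) 1 = 32 * N / c' := by
    rw [max_eq_left (by nlinarith), div_eq_mul_inv]; ring
  have hpow : (N : ℝ) ^ 2 * (32 * N / c') = 32 * (N : ℝ) ^ 3 / c' := by ring
  have hexp : -(-Real.log c' / rW / mv) * ((R' : ℝ) * T) = -(-Real.log c' / (rW * mv)) * ((R' : ℝ) * T) := by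
    rw [div_div]
  rw [hmax, hpow, hexp] at h
  exact h

end Ball

/-! ### The Wilson member: explicit torus area law at full Dobrushin rate -/

section Wilson

/-- The zero perturbation is slab-local with every vertical diameter. [folklore] -/
theorem isSlabLocal_zero (mv : ℕ) (L : ℕ) [NeZero L] : IsSlabLocal mv (0 : Perturbation (n + 1) L N) :=
  ⟨fun v t z _ U => by simp [QuasiLocalGaugePerturbation.total], fun X v => ⟨0, by intro U V _; rfl⟩⟩

/-- **EXPLICIT WILSON AREA LAW ON EVERY TORUS** (`SU(N)`, `N ≥ 2`, dimension `n + 1`, tree coupling `β`): from any one-link modulus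
`OneLinkKRModulus N R K` on the slab ball `R ≥ 2n|β/N|` with slab Dobrushin constant `c_W = 2n|β/N|K ≤ 1` and any floor `0 < θ ≤ 1`,
`c' = max(c_W, θ)`: for every `L`, base point, plane and `2R', 2T ≤ L`,
`|⟨W_{R'×T}⟩_{Λ_L,β}| ≤ N · (32N³/c')^T · e^{−(−log c') R' T}` — rate `−log c_W` itself as soon as `θ ≤ c_W`. [folklore] -/
theorem abs_wilsonExpectation_wilsonLoop_le_explicit (hN : 2 ≤ N) (β : ℝ) {R K : ℝ} (hK : 0 ≤ K)
    (hmod : OneLinkKRModulus N R K) (hR : |β / N| * (2 * (n : ℝ)) ≤ R) (hc : 2 * (n : ℝ) * |β / N| * K ≤ 1)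
    {θ : ℝ} (hθ0 : 0 < θ) (hθ1 : θ ≤ 1)
    (L : ℕ) [NeZero L] (x : Site (n + 1) L) {i j : Fin (n + 1)} (hij : i ≠ j) {R' T : ℕ} (hRL : 2 * R' ≤ L)
    (hTL : 2 * T ≤ L) :
    |wilsonExpectation (fundamentalRep (Fin N)) β (wilsonLoop (fundamentalRep (Fin N)) x i j R' T)| ≤
      N * (32 * (N : ℝ) ^ 3 / max (2 * (n : ℝ) * |β / N| * K) θ) ^ T *
        Real.exp (-(-Real.log (max (2 * (n : ℝ) * |β / N| * K) θ)) * ((R' : ℝ) * T)) := by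
  have h := abs_expectation_wilsonLoop_le_onBall (n := n) hN β hK hmod hR (ε₀ := 0) (ε₁ := 0) le_rfl 0 (mv := 1) le_rfl
    (by simpa using hc) hθ0 hθ1 L 0 (zero_mem_clusterDomainFR le_rfl le_rfl 0) (isSlabLocal_zero 1 L) x hij hRL hTL
  simpa using h

/-- **`SU(2)`, dimension `n + 1`, Wilson coupling `β_W` (tree coupling `β_W/2`), quarter modulus `K = 1` on radius `≤ 1`:** for
`0 < β_W` and `n β_W ≤ 2` the slab Dobrushin constant is `c_W = n β_W/2 ∈ (0, 1]`, and for every torus, base point, plane and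
`2R', 2T ≤ L`:  `|⟨W_{R'×T}⟩_{Λ_L,β_W}| ≤ 2 · (256/(n β_W/2))^T · e^{−log(2/(n β_W)) R' T}`.  (`d = 4`: rate `log(2/(3β_W))` on
`0 < β_W ≤ 2/3`; `d = 3`: rate `log(1/β_W)` on `0 < β_W ≤ 1`.) [folklore] -/
theorem su2_abs_wilsonExpectation_wilsonLoop_le {βW : ℝ} (hβ : 0 < βW) (hβ1 : (n : ℝ) * βW ≤ 2)
    (L : ℕ) [NeZero L] (x : Site (n + 1) L) {i j : Fin (n + 1)} (hij : i ≠ j) {R' T : ℕ} (hRL : 2 * R' ≤ L)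
    (hTL : 2 * T ≤ L) :
    |wilsonExpectation (fundamentalRep (Fin 2)) (βW / 2) (wilsonLoop (fundamentalRep (Fin 2)) x i j R' T)| ≤
      2 * (256 / ((n : ℝ) * βW / 2)) ^ T * Real.exp (-(-Real.log ((n : ℝ) * βW / 2)) * ((R' : ℝ) * T)) := by
  have hn : (0 : ℝ) ≤ n := Nat.cast_nonneg n
  have habs : |βW / 2 / (2 : ℕ)| = βW / 4 := by rw [abs_of_nonneg (by positivity)]; push_cast; ring
  have hcW : 2 * (n : ℝ) * |βW / 2 / (2 : ℕ)| * 1 = n * βW / 2 := by rw [habs]; ring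
  have hmod := SlabAreaLawDimensions.su2_oneLinkKRModulus_of_le_one (R := (n : ℝ) * βW / 2) (by linarith)
  by_cases hn0 : n = 0
  · -- degenerate one-dimensional torus: no plane `i ≠ j`
    subst hn0; exact absurd (Fin.ext (by have := i.isLt; have := j.isLt; omega)) hij
  have hnpos : (0 : ℝ) < n := by exact_mod_cast Nat.pos_of_ne_zero hn0
  have hθ0 : 0 < (n : ℝ) * βW / 2 := by positivity
  have hθ1 : (n : ℝ) * βW / 2 ≤ 1 := by linarith
  have h := abs_wilsonExpectation_wilsonLoop_le_explicit (n := n) (N := 2) le_rfl (βW / 2) zero_le_one hmod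
    (by rw [habs]; linarith) (by rw [hcW]; exact hθ1) hθ0 hθ1 L x hij hRL hTL
  rw [hcW, max_self] at h
  have e1 : ((2 : ℕ) : ℝ) * (32 * ((2 : ℕ) : ℝ) ^ 3 / ((n : ℝ) * βW / 2)) ^ T = 2 * (256 / ((n : ℝ) * βW / 2)) ^ T := by
    norm_num
  rw [e1] at h
  exact h

/-- **Every `N ≥ 2`, dimension `n + 1`, 't Hooft coupling `β/N` (tree `β`), Bakry–Émery modulus** (`K = 1/(1/2 − R)` on the slab ball
`R = 2n|β/N| < 1/2`, hypothesis-free; slab Dobrushin constant `c_W = R/(1/2 − R) ≤ 1` iff `R ≤ 1/4`): for `0 < R ≤ 1/4` and every torus,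
base point, plane, `2R', 2T ≤ L`:  `|⟨W_{R'×T}⟩_{Λ_L,β}| ≤ N (32N³(1/2 − R)/R)^T e^{−log((1/2 − R)/R) R' T}`. [cite: arXiv220412737, Lemma 4.1] -/
theorem suN_abs_wilsonExpectation_wilsonLoop_le (hN : 2 ≤ N) {β : ℝ} (hβ : 0 < |β / N| * (2 * (n : ℝ)))
    (hR : |β / N| * (2 * (n : ℝ)) ≤ 1 / 4)
    (L : ℕ) [NeZero L] (x : Site (n + 1) L) {i j : Fin (n + 1)} (hij : i ≠ j) {R' T : ℕ} (hRL : 2 * R' ≤ L)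
    (hTL : 2 * T ≤ L) :
    |wilsonExpectation (fundamentalRep (Fin N)) β (wilsonLoop (fundamentalRep (Fin N)) x i j R' T)| ≤
      N * (32 * (N : ℝ) ^ 3 / (|β / N| * (2 * (n : ℝ)) / (1 / 2 - |β / N| * (2 * (n : ℝ))))) ^ T *
        Real.exp (-(-Real.log (|β / N| * (2 * (n : ℝ)) / (1 / 2 - |β / N| * (2 * (n : ℝ))))) * ((R' : ℝ) * T)) := by
  set Rs : ℝ := |β / N| * (2 * (n : ℝ)) with hRs
  have hlt : Rs < 1 / 2 := by linarith
  have hpos : 0 < 1 / 2 - Rs := by linarith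
  have hK : 0 ≤ 1 / (1 / 2 - Rs) := by positivity
  have hmod := Balaban1983to89.StrongCouplingKernelWindow.oneLinkKRModulus_SU hN hlt
  have hcW : 2 * (n : ℝ) * |β / N| * (1 / (1 / 2 - Rs)) = Rs / (1 / 2 - Rs) := by rw [hRs]; ring
  have hθ0 : 0 < Rs / (1 / 2 - Rs) := div_pos hβ hpos
  have hθ1 : Rs / (1 / 2 - Rs) ≤ 1 := by rw [div_le_one hpos]; linarith
  have h := abs_wilsonExpectation_wilsonLoop_le_explicit (n := n) hN β hK hmod le_rfl (by rw [hcW]; exact hθ1) hθ0 hθ1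
    L x hij hRL hTL
  rwa [hcW, max_self] at h

end Wilson

end Summit.Ventures.YMGap.RobustBall
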